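import Summits.QuantumFields.BalabanUV.T4Continuum.Support.NE3CovariantLineSumCore
import Summits.QuantumFields.BalabanUV.T4Continuum.Support.NE3CovariantSBound
import HarnessLib

/-!
# NE3SlicePoincareCoreBound (T⁴ programme, node NE3, row K6 of the owner's ruling ρ-g22-2, part K6b-0 of the cut ρ-g23-3 §3) — (S3∕S4a)∘(S4b):
# THE CORE AT W WITH THE S-BOUND SUBSTITUTED, `h² ≤ 18·M²·CG + 16·M⁻²·R + (80d + 448)·d²·(M²a)²·h²`, `R` NAMED

NE3 (node U1b) formalisation swarm `b2b-balaban-t4-ne3-formalise-*`, leaf seat `b2b-balaban-t4-ne3-formalise-leaf-02` (gen 6), row **K6**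
(assembly of the curved (P♮), booked → leaf-02 lineage; blueprint `HOME/t4/b2b-balaban-t4-ne3-p1/g23/D-ne3p1-g23-1.md` = ruling ρ-g23-3 §1 (S3∕S4a)+(S4b),
disprover check D-ne3r2-g8-2 (1): «`8M^{−(d+2)}A ≤ 8M²g_diag² + 16M^{−2}R` ⇒ `h² ≤ 18M²g² + 16M^{−2}(R_E + R_ρ + R_loop) + C₁d²θ²h²` ✓»).  Over
leaf-03-g8's K4-d1 `NE3CovariantLineSumCore.sum_nhsNormSq_le_covariant_torus'` and the owner's K4-d2 `NE3CovariantSBound.sum_nhsNormSq_TWg_le` ∕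
`nhsNormSq_cDstar_shift` BY NAME; nothing else.  All [folklore], 0 sorry, 0 def:
§1 `covFd_add_period` (periodicity of the covariant difference), `sum_nhsNormSq_cDstar_shift_le` (the S-bound's diagonal term is at most the full
   covariant-gradient energy `CG := Σ_xΣ_μΣ_ν nhsNormSq (covFd W η x μ ν)` — periodic shift `sum_periodBox_shift`, diagonal ≤ all pairs);
§2 **`sum_nhsNormSq_le_core_sbound`**: for `M, N ≥ 1`, unitary `(M·N)`-periodic small-field `W` (`0 ≤ a`, `SmallField W a`), `(M·N)`-periodic `η`, ANY unitary
   `N`-periodic coarse `U` and ANY `N`-periodic `ψ`: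
   `Σ‖η‖² ≤ 18·M²·CG + 16·(M²)⁻¹·R(U, ψ) + (80d + 448)·d²·(M²a)²·Σ‖η‖²`, `R(U, ψ) = R_E + R_ρ + R_loop` = K4-d2's named remainder VERBATIM
   (`Σ hsR (JmpW M W (ω − cD U ψ)) η − M²·Σ hsR (covDiv W η) (psiExt M W ψ) + M²·Σ hsR ψ (combDefect + coarseMismatch − Σ_κ (farDefect + nearDefect))`,
   `ω := (M^d)⁻¹ • TWg M (combFrame W M) η`).  K6c instantiates `U := cavgIter L k W`, `ψ := bmeanIterW L k W ζ′`, `η := η′` and feeds the three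
   pairings (K6b-1 `NE3SlicePoincareRemainderRho`, K6b-2a `NE3SlicePoincareRemainderComb` + leaf-03-g8's K6-face, K6b-3).
HONEST FRAMING.  Bookkeeping on OUR lattice objects at ONE unitary background in the small-field class; nothing about Bałaban's minimisers;
(P♮)_W, (ML_w) at `W ≠ 1`, T-E_w and NE3 are NOT proved; spine PROVED 0∕9; finite T⁴ rung (B)+1 — NOT infinite volume, NOT mass gap, NOT
BetaPertH, NOT Clay.  ABSOLUTE RULE kept: no printed sentence is a hypothesis (context only: [Balaban1985Averaging] (120)–(125) pp. 35–36;
[Balaban1985PropagatorsII] Thm 3.3 (3.46)).  PLACEMENT: `Summits/QuantumFields/BalabanUV/`; imports accepted modules only; moves nothing.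
HONEST DEPENDENCY: continuum YM on T⁴ ⇐ BetaPertH ∧ nine spine estimates (0/9 proved); BetaPertH ⇐ (D1) ∧ (D4) ∧ CAP+tail; G-an2-4
gates asym, D1 and NE2/3/4.
-/

set_option autoImplicit false

open scoped BigOperators Matrix.Norms.L2Operator
open Finset

namespace Summit.QuantumFields.BalabanUV.T4Continuum.NE3SlicePoincareCoreBound

open Literature.MathematicalPhysics.QuantumFieldTheory.Balaban1983to89
open B7Prop1Explicit B7Prop2Explicit MatrixNorms
open T4AveragingDeficitWall (IsUnitaryCfg SmallField Ad)
open T4AveragingDeficitWallBoundary (periodBox IsPeriodicCfg sum_periodBox_shift)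
open AveragingDeficitCovGrad (covFd)
open NE3CovariantCalculus (hsR cD cDstar)
open NE3CovariantWeitzenbock (covDiv)
open NE3CovariantLineAdjoint (TWg combFrame JmpW)
open NE3CovariantBlockDivergence (combDefect farDefect nearDefect)
open NE3CovariantLandauKill (coarseMismatch psiExt)
open NE3CovariantLineSumCore (sum_nhsNormSq_le_covariant_torus')
open NE3CovariantSBound (sum_nhsNormSq_TWg_le nhsNormSq_cDstar_shift)

noncomputable section

variable {d : ℕ} {n : Type*} [Fintype n] [DecidableEq n]

/-! ## §1 The diagonal term of the S-bound is at most the covariant-gradient energy -/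

/-- Periodicity of the covariant difference for periodic data. [folklore] -/
theorem covFd_add_period {P : ℕ} {W : Site d → Fin d → (Matrix n n ℂ)ˣ} (hWP : IsPeriodicCfg W (P : ℤ)) {η : Site d → Fin d → Matrix n n ℂ}
    (hη : ∀ (x : Site d) (τ μ : Fin d), η (x + (P : ℤ) • e τ) μ = η x μ) (x : Site d) (τ μ ν : Fin d) :
    covFd W η (x + (P : ℤ) • e τ) μ ν = covFd W η x μ ν := by
  unfold covFd
  rw [hWP x τ μ, add_right_comm, hWP (x + e μ) τ ν, hη (x + e μ) τ ν, hη x τ ν, hWP x τ ν]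

/-- **`Σ_xΣ_κ nhsNormSq (cDstar V_κ κ (η · κ) x) ≤ Σ_xΣ_μΣ_ν nhsNormSq (covFd W η x μ ν)`** over one period (unitary `P`-periodic `W`, `P`-periodic `η`,
`P ≥ 1`): the shifted-configuration term of the S-bound is the DIAGONAL part of the covariant-gradient energy. [folklore] -/
theorem sum_nhsNormSq_cDstar_shift_le {P : ℕ} (hP : 1 ≤ P) {W : Site d → Fin d → (Matrix n n ℂ)ˣ} (hW : IsUnitaryCfg W)
    (hWP : IsPeriodicCfg W (P : ℤ)) {η : Site d → Fin d → Matrix n n ℂ} (hη : ∀ (x : Site d) (τ μ : Fin d), η (x + (P : ℤ) • e τ) μ = η x μ) :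
    ∑ x ∈ periodBox (d := d) P, ∑ κ : Fin d, nhsNormSq (cDstar (fun y μ => W (y + e κ) μ) κ (fun y => η y κ) x)
      ≤ ∑ x ∈ periodBox (d := d) P, ∑ μ : Fin d, ∑ ν : Fin d, nhsNormSq (covFd W η x μ ν) := by
  -- rewrite each term as the diagonal covariant difference at `x − e_κ`, shift back, then diagonal ≤ all pairs
  have hdiag : ∀ κ : Fin d, ∑ x ∈ periodBox (d := d) P, nhsNormSq (cDstar (fun y μ => W (y + e κ) μ) κ (fun y => η y κ) x)
      = ∑ x ∈ periodBox (d := d) P, nhsNormSq (covFd W η x κ κ) := by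
    intro κ
    simp_rw [nhsNormSq_cDstar_shift hW η]
    have hper : ∀ (x : Site d) (τ : Fin d), nhsNormSq (covFd W η (x + (P : ℤ) • e τ) κ κ) = nhsNormSq (covFd W η x κ κ) := by
      intro x τ; rw [covFd_add_period hWP hη]
    have h := sum_periodBox_shift (d := d) P hP (g := fun x => nhsNormSq (covFd W η x κ κ)) hper (-e κ)
    simp only [← sub_eq_add_neg] at h
    exact h
  rw [Finset.sum_comm]
  simp_rw [hdiag]
  rw [Finset.sum_comm]
  refine Finset.sum_le_sum fun x _ => Finset.sum_le_sum fun μ _ => ?_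
  exact Finset.single_le_sum (f := fun ν => nhsNormSq (covFd W η x μ ν)) (fun ν _ => nhsNormSq_nonneg _) (Finset.mem_univ μ)

/-! ## §2 The core with the S-bound substituted -/

/-- **(S3∕S4a)∘(S4b) — THE CORE AT W WITH THE S-BOUND SUBSTITUTED**: for `M, N ≥ 1`, unitary `(M·N)`-periodic `W` with `SmallField W a` (`0 ≤ a`),
an `(M·N)`-periodic `η`, ANY unitary `N`-periodic `U` and `N`-periodic `ψ`:
`Σ‖η‖² ≤ 18·M²·CG + 16·(M²)⁻¹·R(U,ψ) + (80d + 448)·d²·(M²a)²·Σ‖η‖²` with K4-d2's named remainder `R(U,ψ)` verbatim. [folklore] -/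
theorem sum_nhsNormSq_le_core_sbound [Nonempty n] {M N : ℕ} (hM : 1 ≤ M) (hN : 1 ≤ N) {W : Site d → Fin d → (Matrix n n ℂ)ˣ}
    (hW : IsUnitaryCfg W) (hWP : IsPeriodicCfg W ((M * N : ℕ) : ℤ)) {a : ℝ} (ha : 0 ≤ a) (hWa : SmallField W a)
    {η : Site d → Fin d → Matrix n n ℂ} (hη : ∀ (x : Site d) (τ μ : Fin d), η (x + ((M * N : ℕ) : ℤ) • e τ) μ = η x μ)
    {U : Site d → Fin d → (Matrix n n ℂ)ˣ} (hU : IsUnitaryCfg U) (hUP : IsPeriodicCfg U (N : ℤ))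
    {ψ : Site d → Matrix n n ℂ} (hψ : ∀ (z : Site d) (τ : Fin d), ψ (z + (N : ℤ) • e τ) = ψ z) :
    ∑ x ∈ periodBox (d := d) (M * N), ∑ κ : Fin d, nhsNormSq (η x κ)
      ≤ 18 * (M : ℝ) ^ 2 * ∑ x ∈ periodBox (d := d) (M * N), ∑ μ : Fin d, ∑ ν : Fin d, nhsNormSq (covFd W η x μ ν)
        + 16 * ((M : ℝ) ^ 2)⁻¹ *
          (∑ x ∈ periodBox (d := d) (M * N), ∑ κ : Fin d,
              hsR (JmpW M W (fun z μ => (((M : ℝ) ^ d)⁻¹ • TWg M (combFrame W M) η z μ) - cD U μ ψ z) x κ) (η x κ)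
            - (M : ℝ) ^ 2 * ∑ y ∈ periodBox (d := d) (M * N), hsR (covDiv W η y) (psiExt M W ψ y)
            + (M : ℝ) ^ 2 * ∑ z ∈ periodBox (d := d) N, hsR (ψ z)
                (combDefect W M η z + coarseMismatch U W M η z - ∑ κ : Fin d, (farDefect W M η z κ + nearDefect W M η z κ)))
        + (80 * d + 448) * (d : ℝ) ^ 2 * ((M : ℝ) ^ 2 * a) ^ 2 * ∑ x ∈ periodBox (d := d) (M * N), ∑ κ : Fin d, nhsNormSq (η x κ) := by
  have hMN : 1 ≤ M * N := Nat.one_le_iff_ne_zero.2 (Nat.mul_ne_zero (by omega) (by omega))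
  have hcore := sum_nhsNormSq_le_covariant_torus' hM hN hW hWP ha hWa η hη
  have hS := sum_nhsNormSq_TWg_le hM hN hW hWP hη hU hUP hψ
  have hdiag := sum_nhsNormSq_cDstar_shift_le hMN hW hWP hη
  have hM0 : (0 : ℝ) < M := by exact_mod_cast (by omega : 0 < M)
  have hMd : (0 : ℝ) < (M : ℝ) ^ 2 * (M : ℝ) ^ d := by positivity
  -- abbreviations
  set CG := ∑ x ∈ periodBox (d := d) (M * N), ∑ μ : Fin d, ∑ ν : Fin d, nhsNormSq (covFd W η x μ ν) with hCG
  set TT := ∑ z ∈ periodBox (d := d) N, ∑ κ : Fin d, nhsNormSq (TWg M (combFrame W M) η z κ) with hTT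
  set D := ∑ x ∈ periodBox (d := d) (M * N), ∑ κ : Fin d, nhsNormSq (cDstar (fun y μ => W (y + e κ) μ) κ (fun y => η y κ) x) with hD
  set R := ∑ x ∈ periodBox (d := d) (M * N), ∑ κ : Fin d,
              hsR (JmpW M W (fun z μ => (((M : ℝ) ^ d)⁻¹ • TWg M (combFrame W M) η z μ) - cD U μ ψ z) x κ) (η x κ)
            - (M : ℝ) ^ 2 * ∑ y ∈ periodBox (d := d) (M * N), hsR (covDiv W η y) (psiExt M W ψ y)
            + (M : ℝ) ^ 2 * ∑ z ∈ periodBox (d := d) N, hsR (ψ z)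
                (combDefect W M η z + coarseMismatch U W M η z - ∑ κ : Fin d, (farDefect W M η z κ + nearDefect W M η z κ)) with hR
  -- `8·(M²M^d)⁻¹·TT ≤ 8·M²·D + 16·M⁻²·R`
  have hstep : 8 * ((M : ℝ) ^ 2 * (M : ℝ) ^ d)⁻¹ * TT ≤ 8 * (M : ℝ) ^ 2 * D + 16 * ((M : ℝ) ^ 2)⁻¹ * R := by
    have h1 : 8 * ((M : ℝ) ^ 2 * (M : ℝ) ^ d)⁻¹ * TT ≤ 8 * ((M : ℝ) ^ 2 * (M : ℝ) ^ d)⁻¹ * ((M : ℝ) ^ (d + 4) * D + 2 * (M : ℝ) ^ d * R) :=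
      mul_le_mul_of_nonneg_left hS (by positivity)
    have h2 : 8 * ((M : ℝ) ^ 2 * (M : ℝ) ^ d)⁻¹ * ((M : ℝ) ^ (d + 4) * D + 2 * (M : ℝ) ^ d * R)
        = 8 * (M : ℝ) ^ 2 * D + 16 * ((M : ℝ) ^ 2)⁻¹ * R := by
      field_simp
      ring
    linarith
  have hD' : 8 * (M : ℝ) ^ 2 * D ≤ 8 * (M : ℝ) ^ 2 * CG := mul_le_mul_of_nonneg_left hdiag (by positivity)
  linarith

end

end Summit.QuantumFields.BalabanUV.T4Continuum.NE3SlicePoincareCoreBound
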